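import Summits.QuantumAdvantage.AdviceFreeQNC0.SeedJuntaSlack39B
import HarnessLib

/-!
# Cell qa-qnc0, `p = 3` — the (J3)_{r=1} DICHOTOMY as one tree theorem: a heavy W-greedy remainder, or `θ`-hard — unconditionally
# (prover qn-prover-3 g27; sequel of `SeedJuntaSlack39B`)

ROUND-37 §3.1 (planner qa-qnc0-p1 g38) splits a private-forms strategy `x ↦ tGuess x k ⊕ G k (⟨ℓ_k, x⟩ mod 3)` by running Lemma S on its forms:
(A) all greedy remainders polylog-sparse ⇒ seed ⊕ junta (conditional on (R1) at the time), (B) a heavy remainder ⇒ the residual core.  With Lemma S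
relative to a tolerance set (`LinJunta39.exists_seedDecompositionOff_slack`) and the unconditional structured branch under the slack schedule
(`GradedSeeds38.perOutputForms_structured_slackX'`), case (A) no longer needs (R1).  This file records the dichotomy itself:

* ★ **`GradedSeeds38.perOutputForms_dichotomy`** — ONE `θ < 1`; for every `E, C` constants `D, n₀`; for `N ≥ n₀`, every `W` with `3·#W ≤ N`, every
  family `ℓ : Fin N → (Fin N → 𝔽₃)` and tables `G`: EITHER the family has a W-greedy decomposition under the slack schedule
  `w(j) = N/(log₂N)^E + (log₂N)^{2C+E}·(50(j+1) + D·log₂N)` — injective seeds `s`, `ℓ_k = Σ_j a_{kj} ℓ_{s j} + rem_k`, seeds graded-spread off `W`,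
  every `#(supp rem_k ∖ W) < w(R)` — with SOME remainder of off-`W` weight `> (log₂N)^C − 2` (case (B), the residual core relative to `W`), OR the
  strategy wins the `p = 3` ring game on `≤ θ·2^{N−1}` odd inputs (case (A), proved).  Unconditional; the only trace of (R1) is the slack `N/(log₂N)^E`.

WHAT THIS IS NOT: case (B) is not bounded here (p2's decimation theorems / the residual core of ROUND-37 §4); `r = 1` and the x-frame only (the
`r`-forms and walk-frame structured branches are in `SeedJuntaSlack39B`); crux `stmt-QuantumAdvantage-22907` untouched; no ledger item (D-0168 shelf).
-/

noncomputable section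

namespace Summit.QuantumAdvantage.AdviceFreeQNC0

open Finset Literature.Computability.QuantumComplexity Literature.Computability.QuantumComplexity.RingHLF
open Literature.Computability.MetaComplexity

namespace GradedSeeds38

open TwistedJunta36 LinJunta39

open scoped Classical in
/-- ★ **THE (J3)_{r=1} DICHOTOMY RELATIVE TO A TOLERANCE SET — UNCONDITIONAL.**  ONE `θ < 1`; for every `E, C` constants `D, n₀`; for `N ≥ n₀`, every
`W` with `3·#W ≤ N`, every family of private forms `ℓ` and tables `G`: EITHER (B) there is a W-greedy seed decomposition of `ℓ` under the slack
schedule `w(j) = N/(log₂N)^E + (log₂N)^{2C+E}·(50(j+1) + D·log₂N)` (injective seeds from the family, graded-spread off `W`, `ℓ_k = Σ_j a_{kj} ℓ_{s j} + rem_k`,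
all `#(supp rem_k ∖ W) < w(R)`) one of whose remainders has off-`W` weight `> (log₂N)^C − 2`, OR (A) the strategy `x ↦ tGuess x k ⊕ G k (⟨ℓ_k,x⟩)`
wins on `≤ θ·2^{N−1}` odd inputs.  (`exists_seedDecompositionOff_slack` + `perOutputForms_structured_slackX'` at `r = 1`.) -/
theorem perOutputForms_dichotomy :
    ∃ θ : ℝ, θ < 1 ∧ ∀ E C : ℕ, ∃ D n₀ : ℕ, ∀ N ≥ n₀,
      ∀ (W : Finset (Fin N)) (ℓ : Fin N → Fin N → ZMod 3) (G : Fin N → ZMod 3 → Bool), 3 * W.card ≤ N →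
        (∃ (R : ℕ) (s : Fin R → Fin N) (a : Fin N → Fin R → ZMod 3) (rem : Fin N → Fin N → ZMod 3),
          Function.Injective s ∧
          (∀ k m, ℓ k m = ∑ j, a k j * ℓ (s j) m + rem k m) ∧
          GradedSpreadOff W (fun j => ℓ (s j)) (fun j =>
            N / Nat.log 2 N ^ E + (Nat.log 2 N) ^ (2 * C + E) * (50 * (j.val + 1) + D * Nat.log 2 N)) ∧
          (∀ k, (suppOff W (rem k)).card
            < N / Nat.log 2 N ^ E + (Nat.log 2 N) ^ (2 * C + E) * (50 * (R + 1) + D * Nat.log 2 N)) ∧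
          ∃ k, (Nat.log 2 N) ^ C < (suppOff W (rem k)).card + 2)
        ∨ ((univ.filter fun x : Fin N → Bool =>
              OddZeros x ∧ RingHLF.Rel x (fun k => xor (tGuess x k) (G k (linVal (ℓ k) x)))).card : ℝ)
            ≤ θ * (2 : ℝ) ^ (N - 1) := by
  obtain ⟨θ, hθ, hall⟩ := perOutputForms_structured_slackX'
  refine ⟨θ, hθ, fun E C => ?_⟩
  obtain ⟨D, n₀, hD⟩ := hall E C
  refine ⟨D, max n₀ 2, fun N hN W ℓ G hW => ?_⟩
  have hN0 : n₀ ≤ N := le_trans (le_max_left _ _) hN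
  have hN2 : 2 ≤ N := le_trans (le_max_right _ _) hN
  obtain ⟨R, s, a, rem, hs, hspread, hdec, hrem⟩ := exists_seedDecompositionOff_slack E C D hN2 W ℓ
  by_cases hB : ∃ k, (Nat.log 2 N) ^ C < (suppOff W (rem k)).card + 2
  · exact Or.inl ⟨R, s, a, rem, hs, hdec, hspread, hrem, hB⟩
  · right
    simp only [not_exists, not_lt] at hB
    -- case (A): every remainder is sparse off `W`; apply the structured branch at `r = 1`
    have h := hD N hN0 W 1 (fun k _ => ℓ k) (fun k v => G k (v 0)) R (fun j => ℓ (s j)) (fun k _ => a k)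
      (fun k _ => rem k) hW (fun k _ m => hdec k m) hspread (fun k => by
        have e : ((univ : Finset (Fin 1)).biUnion fun _ => suppOff W (rem k)) = suppOff W (rem k) := by
          ext m; simp
        rw [e]; exact hB k)
    simpa using h

end GradedSeeds38

end Summit.QuantumAdvantage.AdviceFreeQNC0

end
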